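import Summits.QuantumFields.BalabanUV.Beta.GAN24.PerturbedInsertionChainVolumeLimit

/-!
# `BalabanUV.Beta.GAN24.BackgroundExpansionTaylorCoupling` — binder row G-an2-4 ∕ (CONV-C), route R7 «TWO CURRENCIES», PART 163: EVERY u-DERIVATIVE OF THE EFFECTIVE FORM WITH
# BACKGROUND AT EVERY COUPLING `u₀` OF THE DISC, ON `ℤ^d`, MODULO ONLY THE BACKGROUND's POINTWISE LIMIT.  PART 161 proved the uniform Faà di Bruno identity `∂^N_u[(c_k(u))⁻¹] =
# Σ_i z_i • diagram(ℓ_i)(u)` at EVERY `u` with `Δ_a + uP`, `c_k(u)` invertible, and the END at `u = 0` (PART 160's letters).  At `u₀ ≠ 0` the letters are `c_k(u₀)⁻¹` (PART 129 ∕ 152: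
# (UD), (SR), EL₂ on the disc) and the chains `X^{(j)}_k(u₀)` (PART 162: the INPUT triple on the disc); PART 160's closure of the INPUT triple under finite products and finite linear
# combinations and PART 140's generic END give the result: the whole real-analytic germ of `u ↦ Σ_k(u)` at every point of PART 129's coupling disc is in the β-cell's `LimitRate`
# currency on `ℤ^d`, volume family by volume family, modulo only EL₁ of the background (unit b2b-balaban-gan24-p3, gen 56; v1)

NOT IN PRINT; OUR PROOF ([folklore] bookkeeping BY NAME over PART 161 (`iteratedDeriv_inv_eq_diagramSum`, `exists_clm_avgTow`), PART 162 (`pertChain_inputs`), PART 129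
(`exists_decay_inv_pertCov_QB`, `twoLevelDecayRate_effForm_perturbed`), PART 152 (`tendsto_inv_pertCov_pair`, `opNorm_one_sub_smul_pertCov_le`, `one_sub_half_ratio_lt_one`), PART 160
(`list_prod_inputs`, `sum_inputs`), PART 128 ∕ 130 (`entryDecay_of_le_rate`, `twoLevelDecayRate_of_le_rate`), PART 140 (`conv_of_decay_of_tendsto`), PART 115 (`pow_mul_shift`), NE2's `isUnit_det_add_smul_right` ∕
`isUnit_one_add_of_opNorm_lt_one` ∕ `perturbationLaws_firstOrder` ∕ `isUnit_det_calDalev`; [Balaban1987RG1] (1.21)–(1.22) p. 264 LOCATE the shapes; nothing printed is a hypothesis).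
HONEST FRAMING (cell contract, verbatim): «discharging `BetaPertH` makes Bałaban's UV stability UNCONDITIONAL — a real constructive-QFT result; it is NOT the
continuum limit and NOT the Clay problem.»  HONEST DEPENDENCY (verbatim): «continuum YM on T⁴ ⇐ BetaPertH ∧ nine spine estimates (0/9 proved); BetaPertH ⇐
(D1) ∧ (D4) ∧ CAP+tail; G-an2-4 gates asym, D1 and NE2/3/4.»

WHAT THIS FILE PROVES (0 sorry, 0 `def`; `c_k(u) = L^{dk}Q_k(Δ_a^{(k)} + uP(V_t)^{(k)})⁻¹Q_kᴴ`, `R_k(u) = (Δ_a^{(k)} + uP^{(k)})⁻¹`, `X^{(j)}_k(u) = L^{dk}Q_k((R_k(u)P)^jR_k(u))Q_kᴴ`; PART 129's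
disc: `a′ > 0`, `κ > 0` admissible, `T ≥ 0`, `Tκ₀ ≤ 1∕2`, `Tκ_c ≤ 1∕2`, `4Tκ₀Cst ≤ γ_B`; `‖u₀‖ ≤ T`; `d ≥ 3`, `L ≥ 2`, `a > 0`, even cubic volumes `2(t+1)`; ONE volume-indexed family of
Lipschitz backgrounds `V_t` with `(α, β)` uniform, DISPLAYING ONLY EL₁):
* §1 `isUnit_det_of_opNorm_one_sub_smul_reindex_lt`, `isUnit_det_pertCov` (`c_k(u₀)` is invertible on the disc), **`invPertCov_inputs`** (the INPUT triple of `c_k(u₀)⁻¹` along the even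
  cubic volumes — PART 129 ∕ 152 repackaged), `pertLetter_inputs`, **`pertDiagramSum_inputs`** (every finite `ℂ`-combination of finite products of the letters `c_k(u₀)⁻¹`, `X^{(j)}_k(u₀)`).
* §2 **`conv_iteratedDeriv_invPertCov_at_coupling`** (`μ ≠ ν`, every `N`): the tower family `(t, k) ↦ ∂^N_u[(c_k(u))⁻¹]|_{u = u₀}` has `∃ κ₁ > 0, B, B′ ≥ 0, Π` with `IsInfiniteVolumeLimit`,
  `UniformDecay Π μ ν B (κ₁∕d)`, `StepRate Π μ ν B′ (κ₁∕d) (√(L⁻¹))`, `KernelInputs d Π`, `∀ k, |secondMoment (Π k) μ ν − secondMoment (limKernelOf Π) μ ν| ≤ β′_d(B′∕(1−√(L⁻¹)), κ₁∕d)·(√(L⁻¹))^k`;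
  **`conv_iteratedDeriv_effFormPert_at_coupling`** — the same for `∂^N_uΣ_k(u)|_{u₀}`, `Σ_k(u) = c_k(u)⁻¹ − a″1`, `N ≥ 1` (PART 152 is `N = 0`; PART 161 is `u₀ = 0`).
WHAT IT DOES NOT DO: several background directions at once; large couplings; `d ≤ 2` ∕ odd volumes; Bałaban's `Π⁰_{k+1}` ∕ `U_k` (row an1's dictionary).  SUPPLIER work; NEVER
«G-an2-4 closed»; NOT (CONV-C), NOT D1, NOT `BetaPertH`, NOT continuum, NOT Clay.  Records: `HOME/b2b-balaban-gan24-p3/gen56/README.md`.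
-/

noncomputable section

open scoped BigOperators ComplexConjugate Matrix Matrix.Norms.L2Operator
open Filter Topology

namespace Summit.QuantumFields.BalabanUV.Beta.GAN24.BackgroundExpansionTaylorCoupling

open Literature.MathematicalPhysics.QuantumFieldTheory.Balaban1983to89
open Literature.MathematicalPhysics.QuantumFieldTheory.Balaban1983to89.B5Prop11Plancherel (Tor Cst Cst_nonneg)
open Literature.MathematicalPhysics.QuantumFieldTheory.Balaban1983to89.B5G183RateUnitTower (lev)
open Literature.MathematicalPhysics.QuantumFieldTheory.Balaban1983to89.B12Sec2to5 (betaPrime510)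
open Literature.MathematicalPhysics.QuantumFieldTheory.Balaban1983to89.Beta (Site IsInfiniteVolumeLimit)
open Literature.MathematicalPhysics.QuantumFieldTheory.Balaban1983to89.Beta.FreeLegDictionary (cubic)
open Literature.MathematicalPhysics.QuantumFieldTheory.Balaban1983to89.Beta.BlockKernelVolumeSockets (evenPeriod tendsto_evenPeriod)
open Literature.MathematicalPhysics.QuantumFieldTheory.Balaban1983to89.Beta.VectorTails (castT)
open Literature.MathematicalPhysics.QuantumFieldTheory.Balaban1983to89.Beta.LimitRate (StepRate limKernelOf KernelInputs)
open Summit.QuantumFields.BalabanUV.T4Continuum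
open Summit.QuantumFields.BalabanUV.T4Continuum.CovariantAveragingTower (avgTow)
open Summit.QuantumFields.BalabanUV.T4Continuum.BalabanAveragedTowerUnit (idx QBlev calGlev)
open Summit.QuantumFields.BalabanUV.T4Continuum.BalabanAveragedCoerciveTower (unitIdx)
open Summit.QuantumFields.BalabanUV.T4Continuum.BalabanAveragedCoercive (gammaB)
open Summit.QuantumFields.BalabanUV.T4Continuum.BackgroundResolventLaw (isUnit_det_add_smul_right isUnit_one_add_of_opNorm_lt_one)
open Summit.QuantumFields.BalabanUV.T4Continuum.KingPairingPlantedLaw (calDalev isUnit_det_calDalev)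
open Summit.QuantumFields.BalabanUV.T4Continuum.FirstOrderBackgroundModel (LipschitzBackground Pmodel perturbationLaws_firstOrder)
open Summit.QuantumFields.BalabanUV.T4Continuum.CTKingTowerWeights (distK)
open Summit.QuantumFields.BalabanUV.T4Continuum.CTConjugatedHbd (G2)
open Summit.QuantumFields.BalabanUV.T4Continuum.DirichletRegionTower (gamD)
open Summit.QuantumFields.BalabanUV.T4Continuum.ScalarAveragedPropagator (gammaPs)
open Summit.QuantumFields.BalabanUV.T4Continuum.ScalarAveragedCompression (sigma0)
open Summit.QuantumFields.BalabanUV.T4Continuum.CTScalarGreen (Jfree)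
open Summit.QuantumFields.BalabanUV.T4Continuum.CTGaugeTerm (deltaK)
open Summit.QuantumFields.BalabanUV.T4Continuum.CTVectorPropagator (JA)
open Summit.QuantumFields.BalabanUV.T4Continuum.DecayRateInterpolation (EntryDecay TwoLevelDecayRate)
open Summit.QuantumFields.BalabanUV.Beta.GAN24.DiagramDecayAlgebra (twoLevelDecayRate_const_nonneg twoLevelDecayRate_of_le_rate)
open Summit.QuantumFields.BalabanUV.Beta.GAN24.UnitLatticeDecayAlgebra (distK_nonneg)
open Summit.QuantumFields.BalabanUV.Beta.GAN24.EffectiveFormDecay (entryDecay_of_le_rate)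
open Summit.QuantumFields.BalabanUV.Beta.GAN24.DiagramVolumeLimit (conv_of_decay_of_tendsto)
open Summit.QuantumFields.BalabanUV.Beta.GAN24.EffectiveFormDecayBackground (exists_decay_inv_pertCov_QB twoLevelDecayRate_effForm_perturbed)
open Summit.QuantumFields.BalabanUV.Beta.GAN24.PerturbedEffectiveFormVolumeLimit (tendsto_inv_pertCov_pair opNorm_one_sub_smul_pertCov_le one_sub_half_ratio_lt_one)
open Summit.QuantumFields.BalabanUV.Beta.GAN24.BackgroundExpansionAllOrders (list_prod_inputs sum_inputs)
open Summit.QuantumFields.BalabanUV.Beta.GAN24.BackgroundExpansionTaylor (iteratedDeriv_inv_eq_diagramSum exists_clm_avgTow)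
open Summit.QuantumFields.BalabanUV.Beta.GAN24.PerturbedInsertionChainVolumeLimit (pertChain_inputs)

variable {d : ℕ} (L : ℕ) [NeZero L] (a : ℝ) (ha : 0 < a)

/-! ## §1 The letters at a coupling `u₀` and their INPUT triples -/

section Letters

omit [NeZero L] in
/-- Neumann: `‖1 − τ•(reindex e e A)‖ < 1` ⟹ `det A` is a unit (and `τ ≠ 0`). [folklore] -/
theorem isUnit_det_of_opNorm_one_sub_smul_reindex_lt {ι ι' : Type*} [Fintype ι] [DecidableEq ι] [Fintype ι'] [DecidableEq ι'] (e : ι ≃ ι') {A : Matrix ι ι ℂ} {τ : ℂ}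
    (h : ‖(1 : Matrix ι' ι' ℂ) - τ • Matrix.reindex e e A‖ < 1) : IsUnit A.det := by
  have h1 : IsUnit ((1 : Matrix ι' ι' ℂ) + -((1 : Matrix ι' ι' ℂ) - τ • Matrix.reindex e e A)) := isUnit_one_add_of_opNorm_lt_one (by rwa [norm_neg])
  have e1 : (1 : Matrix ι' ι' ℂ) + -((1 : Matrix ι' ι' ℂ) - τ • Matrix.reindex e e A) = τ • Matrix.reindex e e A := by abel
  rw [e1] at h1
  have h2 := (Matrix.isUnit_iff_isUnit_det _).mp h1
  rw [Matrix.det_smul, Matrix.det_reindex_self] at h2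
  exact isUnit_of_mul_isUnit_right h2

/-- **`c_k(u₀)` is invertible on PART 129's disc** (`d ≥ 1`, any torus, `‖u₀‖ ≤ T`, `Tκ₀ ≤ 1∕2`, `4Tκ₀Cst ≤ γ_B`): PART 152's Neumann ratio `‖1 − Cst⁻¹•c_k(u₀)‖ ≤ 1 − γ_B∕(2Cst) < 1`.
[our proof] -/
theorem isUnit_det_pertCov (hd : 1 ≤ d) (M : Fin d → ℕ) [∀ μ, NeZero (M μ)] {V : (k : ℕ) → Fin d → (idx L M k → ℂ)} {α β T : ℝ} (hV : LipschitzBackground L M V α β)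
    (hT₁ : T * (d * (α + β) * Cst d a) ≤ 1 / 2) (hT₃ : 4 * T * (d * (α + β) * Cst d a) * Cst d a ≤ gammaB d a) {u : ℂ} (hu : ‖u‖ ≤ T) (k : ℕ) :
    IsUnit (avgTow (QBlev L M) ((L : ℝ) ^ d) (fun k => (calDalev L M a ha k + u • Pmodel L M V k)⁻¹) k).det :=
  isUnit_det_of_opNorm_one_sub_smul_reindex_lt (unitIdx L M)
    ((opNorm_one_sub_smul_pertCov_le L M a ha hd hV hT₁ hT₃ hu k).trans_lt (one_sub_half_ratio_lt_one a ha))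

/-- **`invPertCov_inputs` — THE INPUT TRIPLE OF `c_k(u₀)⁻¹` ALONG THE EVEN CUBIC VOLUMES** [our proof] (PART 129's (UD) `exists_decay_inv_pertCov_QB` and (SR)
`twoLevelDecayRate_effForm_perturbed` at `a″ = 0`, PART 152's EL₂ `tendsto_inv_pertCov_pair`, at a common rate). -/
theorem invPertCov_inputs (hL : 2 ≤ L) (hd : 3 ≤ d) {α β a' κ T : ℝ} (ha' : 0 < a') (hκ0 : 0 < κ)
    (hγ' : Jfree d a' κ 1 < gammaPs d a') (hδ' : deltaK d a' κ 1 < sigma0 d a' ^ 2) (hJA : JA d a a' κ 1 < gamD d a) (hT0 : 0 ≤ T)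
    (hT₁ : T * (d * (α + β) * Cst d a) ≤ 1 / 2)
    (hT₂ : T * (d * (α * G2 d a (max (JA d a a' κ 1) 0) (gamD d a - max (JA d a a' κ 1) 0) κ)) ≤ 1 / 2)
    (hT₃ : 4 * T * (d * (α + β) * Cst d a) * Cst d a ≤ gammaB d a)
    {V : (t : ℕ) → (k : ℕ) → Fin d → (idx L (cubic d (evenPeriod t)) k → ℂ)} (hV : ∀ t, LipschitzBackground L (cubic d (evenPeriod t)) (V t) α β)
    (hV1 : ∀ k (μ f : Fin d) (z : Fin d → ℤ), ∃ s : ℂ, Tendsto (fun t => V t k μ (castT (cubic d (lev L k * evenPeriod t)) z, f)) atTop (𝓝 s))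
    {u : ℂ} (hu : ‖u‖ ≤ T) :
    ∃ κ₁ B B' : ℝ, 0 < κ₁ ∧ 0 ≤ B ∧ 0 ≤ B' ∧
      (∀ t k, EntryDecay (distK L (cubic d (evenPeriod t))) (avgTow (QBlev L (cubic d (evenPeriod t))) ((L : ℝ) ^ d)
        (fun k' => (calDalev L (cubic d (evenPeriod t)) a ha k' + u • Pmodel L (cubic d (evenPeriod t)) (V t) k')⁻¹) k)⁻¹ B κ₁) ∧
      (∀ t, TwoLevelDecayRate (distK L (cubic d (evenPeriod t))) (fun k => (avgTow (QBlev L (cubic d (evenPeriod t))) ((L : ℝ) ^ d)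
        (fun k' => (calDalev L (cubic d (evenPeriod t)) a ha k' + u • Pmodel L (cubic d (evenPeriod t)) (V t) k')⁻¹) k)⁻¹) B' κ₁ (Real.sqrt ((L : ℝ)⁻¹))) ∧
      (∀ k μ ν (z z' : Fin d → ℤ), ∃ s' : ℂ, Tendsto (fun t => (avgTow (QBlev L (cubic d (evenPeriod t))) ((L : ℝ) ^ d)
        (fun k' => (calDalev L (cubic d (evenPeriod t)) a ha k' + u • Pmodel L (cubic d (evenPeriod t)) (V t) k')⁻¹) k)⁻¹
        ((unitIdx L (cubic d (evenPeriod t))).symm (castT (cubic d (evenPeriod t)) z, μ)) ((unitIdx L (cubic d (evenPeriod t))).symm (castT (cubic d (evenPeriod t)) z', ν)))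
        atTop (𝓝 s')) := by
  have hd1 : 1 ≤ d := le_trans (by norm_num) hd
  have hd2 : 2 ≤ d := le_trans (by norm_num) hd
  have hαβ : 0 ≤ α ∧ 0 ≤ β := (hV 0).nonneg
  have hθ0 : 0 ≤ Real.sqrt ((L : ℝ)⁻¹) := Real.sqrt_nonneg _
  obtain ⟨κ₁, B₁, hκ₁, hB₁, hud⟩ := exists_decay_inv_pertCov_QB L a ha hd2 hαβ ha' hκ0 hγ' hδ' hJA hT0 hT₁ hT₂ hT₃
  obtain ⟨κ₂, B₂, hκ₂, hsr⟩ := twoLevelDecayRate_effForm_perturbed L a ha hL hd2 hαβ ha' hκ0 hγ' hδ' hJA hT0 hT₁ hT₂ hT₃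
  have hsr' : ∀ t, TwoLevelDecayRate (distK L (cubic d (evenPeriod t))) (fun k => (avgTow (QBlev L (cubic d (evenPeriod t))) ((L : ℝ) ^ d)
      (fun k' => (calDalev L (cubic d (evenPeriod t)) a ha k' + u • Pmodel L (cubic d (evenPeriod t)) (V t) k')⁻¹) k)⁻¹) B₂ (κ₂ / 2) (Real.sqrt ((L : ℝ)⁻¹)) := by
    intro t
    have h := hsr (cubic d (evenPeriod t)) (V t) (hV t) u hu 0
    simp only [zero_smul, sub_zero] at h
    exact h
  have hB₂ : 0 ≤ B₂ := by
    haveI : Nonempty (idx L (cubic d (evenPeriod 0)) 0) := ⟨((fun _ => 0), ⟨0, hd1⟩)⟩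
    exact twoLevelDecayRate_const_nonneg (hsr' 0)
  refine ⟨min κ₁ (κ₂ / 2), B₁, B₂, lt_min hκ₁ (half_pos hκ₂), hB₁.le, hB₂, fun t k => ?_, fun t => ?_, fun k μ ν z z' => ?_⟩
  · exact entryDecay_of_le_rate (distK_nonneg L (cubic d (evenPeriod t))) (hud (cubic d (evenPeriod t)) (V t) (hV t) u hu k) hB₁.le (min_le_left _ _)
  · exact twoLevelDecayRate_of_le_rate (distK_nonneg L (cubic d (evenPeriod t))) (hsr' t) hB₂ hθ0 (min_le_right _ _)
  · exact tendsto_inv_pertCov_pair L a ha hd ha' hκ0 hγ' hδ' hJA hT₁ hT₂ hT₃ k hV (hV1 k) hu μ ν z z'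

variable {α β a' κ T : ℝ} {V : (t : ℕ) → (k : ℕ) → Fin d → (idx L (cubic d (evenPeriod t)) k → ℂ)} {u : ℂ}

/-- INPUTS of a LETTER at coupling `u₀`: `c_k(u₀)⁻¹` (`invPertCov_inputs`) or `X^{(j)}_k(u₀)` (PART 162's `pertChain_inputs`). [our proof] -/
theorem pertLetter_inputs (hL : 2 ≤ L) (hd : 3 ≤ d) (ha' : 0 < a') (hκ0 : 0 < κ)
    (hγ' : Jfree d a' κ 1 < gammaPs d a') (hδ' : deltaK d a' κ 1 < sigma0 d a' ^ 2) (hJA : JA d a a' κ 1 < gamD d a) (hT0 : 0 ≤ T)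
    (hT₁ : T * (d * (α + β) * Cst d a) ≤ 1 / 2)
    (hT₂ : T * (d * (α * G2 d a (max (JA d a a' κ 1) 0) (gamD d a - max (JA d a a' κ 1) 0) κ)) ≤ 1 / 2)
    (hT₃ : 4 * T * (d * (α + β) * Cst d a) * Cst d a ≤ gammaB d a)
    (hV : ∀ t, LipschitzBackground L (cubic d (evenPeriod t)) (V t) α β)
    (hV1 : ∀ k (μ f : Fin d) (z : Fin d → ℤ), ∃ s : ℂ, Tendsto (fun t => V t k μ (castT (cubic d (lev L k * evenPeriod t)) z, f)) atTop (𝓝 s))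
    (hu : ‖u‖ ≤ T) (o : Option ℕ) :
    ∃ κ₁ B B' : ℝ, 0 < κ₁ ∧ 0 ≤ B ∧ 0 ≤ B' ∧
      (∀ t k, EntryDecay (distK L (cubic d (evenPeriod t)))
        (o.elim (fun t k => (avgTow (QBlev L (cubic d (evenPeriod t))) ((L : ℝ) ^ d)
            (fun k' => (calDalev L (cubic d (evenPeriod t)) a ha k' + u • Pmodel L (cubic d (evenPeriod t)) (V t) k')⁻¹) k)⁻¹)
          (fun j t k => avgTow (QBlev L (cubic d (evenPeriod t))) ((L : ℝ) ^ d)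
            (fun k' => ((calDalev L (cubic d (evenPeriod t)) a ha k' + u • Pmodel L (cubic d (evenPeriod t)) (V t) k')⁻¹ * Pmodel L (cubic d (evenPeriod t)) (V t) k') ^ j
              * (calDalev L (cubic d (evenPeriod t)) a ha k' + u • Pmodel L (cubic d (evenPeriod t)) (V t) k')⁻¹) k) t k) B κ₁) ∧
      (∀ t, TwoLevelDecayRate (distK L (cubic d (evenPeriod t)))
        (o.elim (fun t k => (avgTow (QBlev L (cubic d (evenPeriod t))) ((L : ℝ) ^ d)
            (fun k' => (calDalev L (cubic d (evenPeriod t)) a ha k' + u • Pmodel L (cubic d (evenPeriod t)) (V t) k')⁻¹) k)⁻¹)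
          (fun j t k => avgTow (QBlev L (cubic d (evenPeriod t))) ((L : ℝ) ^ d)
            (fun k' => ((calDalev L (cubic d (evenPeriod t)) a ha k' + u • Pmodel L (cubic d (evenPeriod t)) (V t) k')⁻¹ * Pmodel L (cubic d (evenPeriod t)) (V t) k') ^ j
              * (calDalev L (cubic d (evenPeriod t)) a ha k' + u • Pmodel L (cubic d (evenPeriod t)) (V t) k')⁻¹) k) t) B' κ₁ (Real.sqrt ((L : ℝ)⁻¹))) ∧
      (∀ k μ ν (z z' : Fin d → ℤ), ∃ s' : ℂ, Tendsto (fun t =>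
        o.elim (fun t k => (avgTow (QBlev L (cubic d (evenPeriod t))) ((L : ℝ) ^ d)
            (fun k' => (calDalev L (cubic d (evenPeriod t)) a ha k' + u • Pmodel L (cubic d (evenPeriod t)) (V t) k')⁻¹) k)⁻¹)
          (fun j t k => avgTow (QBlev L (cubic d (evenPeriod t))) ((L : ℝ) ^ d)
            (fun k' => ((calDalev L (cubic d (evenPeriod t)) a ha k' + u • Pmodel L (cubic d (evenPeriod t)) (V t) k')⁻¹ * Pmodel L (cubic d (evenPeriod t)) (V t) k') ^ j
              * (calDalev L (cubic d (evenPeriod t)) a ha k' + u • Pmodel L (cubic d (evenPeriod t)) (V t) k')⁻¹) k) t k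
        ((unitIdx L (cubic d (evenPeriod t))).symm (castT (cubic d (evenPeriod t)) z, μ)) ((unitIdx L (cubic d (evenPeriod t))).symm (castT (cubic d (evenPeriod t)) z', ν)))
        atTop (𝓝 s')) := by
  cases o with
  | none =>
    obtain ⟨κ₁, B, B', hκ₁, hB, hB', hud, hsr, hel⟩ := invPertCov_inputs L a ha hL hd ha' hκ0 hγ' hδ' hJA hT0 hT₁ hT₂ hT₃ hV hV1 hu
    exact ⟨κ₁, B, B', hκ₁, hB, hB', hud, hsr, hel⟩
  | some j =>
    obtain ⟨κ₁, B, B', hκ₁, hB, hB', hud, hsr, hel⟩ := pertChain_inputs L a ha hL hd (hV 0).nonneg.1 (hV 0).nonneg.2 ha' hκ0 hγ' hδ' hJA hT0 hT₁ hT₂ hV hV1 hu j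
    exact ⟨κ₁, B, B', hκ₁, hB, hB', hud, hsr, hel⟩

/-- **`pertDiagramSum_inputs` — EVERY FINITE LINEAR COMBINATION OF DIAGRAMS IN THE LETTERS `c_k(u₀)⁻¹`, `X^{(j)}_k(u₀)` HAS THE INPUT TRIPLE** [our proof] (PART 160's `list_prod_inputs`
and `sum_inputs` on `pertLetter_inputs`). -/
theorem pertDiagramSum_inputs (hL : 2 ≤ L) (hd : 3 ≤ d) (ha' : 0 < a') (hκ0 : 0 < κ)
    (hγ' : Jfree d a' κ 1 < gammaPs d a') (hδ' : deltaK d a' κ 1 < sigma0 d a' ^ 2) (hJA : JA d a a' κ 1 < gamD d a) (hT0 : 0 ≤ T)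
    (hT₁ : T * (d * (α + β) * Cst d a) ≤ 1 / 2)
    (hT₂ : T * (d * (α * G2 d a (max (JA d a a' κ 1) 0) (gamD d a - max (JA d a a' κ 1) 0) κ)) ≤ 1 / 2)
    (hT₃ : 4 * T * (d * (α + β) * Cst d a) * Cst d a ≤ gammaB d a)
    (hV : ∀ t, LipschitzBackground L (cubic d (evenPeriod t)) (V t) α β)
    (hV1 : ∀ k (μ f : Fin d) (z : Fin d → ℤ), ∃ s : ℂ, Tendsto (fun t => V t k μ (castT (cubic d (lev L k * evenPeriod t)) z, f)) atTop (𝓝 s))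
    (hu : ‖u‖ ≤ T) {J : Type*} (s : Finset J) (coef : J → ℂ) (ℓ : J → List (Option ℕ)) :
    ∃ κ₁ B B' : ℝ, 0 < κ₁ ∧ 0 ≤ B ∧ 0 ≤ B' ∧
      (∀ t k, EntryDecay (distK L (cubic d (evenPeriod t)))
        ((∑ i ∈ s, coef i • ((ℓ i).map fun o : Option ℕ => o.elim
          (fun t k => (avgTow (QBlev L (cubic d (evenPeriod t))) ((L : ℝ) ^ d)
            (fun k' => (calDalev L (cubic d (evenPeriod t)) a ha k' + u • Pmodel L (cubic d (evenPeriod t)) (V t) k')⁻¹) k)⁻¹)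
          (fun j t k => avgTow (QBlev L (cubic d (evenPeriod t))) ((L : ℝ) ^ d)
            (fun k' => ((calDalev L (cubic d (evenPeriod t)) a ha k' + u • Pmodel L (cubic d (evenPeriod t)) (V t) k')⁻¹ * Pmodel L (cubic d (evenPeriod t)) (V t) k') ^ j
              * (calDalev L (cubic d (evenPeriod t)) a ha k' + u • Pmodel L (cubic d (evenPeriod t)) (V t) k')⁻¹) k)).prod) t k) B κ₁) ∧
      (∀ t, TwoLevelDecayRate (distK L (cubic d (evenPeriod t)))
        ((∑ i ∈ s, coef i • ((ℓ i).map fun o : Option ℕ => o.elim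
          (fun t k => (avgTow (QBlev L (cubic d (evenPeriod t))) ((L : ℝ) ^ d)
            (fun k' => (calDalev L (cubic d (evenPeriod t)) a ha k' + u • Pmodel L (cubic d (evenPeriod t)) (V t) k')⁻¹) k)⁻¹)
          (fun j t k => avgTow (QBlev L (cubic d (evenPeriod t))) ((L : ℝ) ^ d)
            (fun k' => ((calDalev L (cubic d (evenPeriod t)) a ha k' + u • Pmodel L (cubic d (evenPeriod t)) (V t) k')⁻¹ * Pmodel L (cubic d (evenPeriod t)) (V t) k') ^ j
              * (calDalev L (cubic d (evenPeriod t)) a ha k' + u • Pmodel L (cubic d (evenPeriod t)) (V t) k')⁻¹) k)).prod) t) B' κ₁ (Real.sqrt ((L : ℝ)⁻¹))) ∧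
      (∀ k μ ν (z z' : Fin d → ℤ), ∃ s' : ℂ, Tendsto (fun t =>
        (∑ i ∈ s, coef i • ((ℓ i).map fun o : Option ℕ => o.elim
          (fun t k => (avgTow (QBlev L (cubic d (evenPeriod t))) ((L : ℝ) ^ d)
            (fun k' => (calDalev L (cubic d (evenPeriod t)) a ha k' + u • Pmodel L (cubic d (evenPeriod t)) (V t) k')⁻¹) k)⁻¹)
          (fun j t k => avgTow (QBlev L (cubic d (evenPeriod t))) ((L : ℝ) ^ d)
            (fun k' => ((calDalev L (cubic d (evenPeriod t)) a ha k' + u • Pmodel L (cubic d (evenPeriod t)) (V t) k')⁻¹ * Pmodel L (cubic d (evenPeriod t)) (V t) k') ^ j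
              * (calDalev L (cubic d (evenPeriod t)) a ha k' + u • Pmodel L (cubic d (evenPeriod t)) (V t) k')⁻¹) k)).prod) t k
        ((unitIdx L (cubic d (evenPeriod t))).symm (castT (cubic d (evenPeriod t)) z, μ)) ((unitIdx L (cubic d (evenPeriod t))).symm (castT (cubic d (evenPeriod t)) z', ν)))
        atTop (𝓝 s')) := by
  have hd2 : 2 ≤ d := le_trans (by norm_num) hd
  refine sum_inputs L (Real.sqrt_nonneg _) s coef _ fun i _ => ?_
  refine list_prod_inputs L hd2 tendsto_evenPeriod (Real.sqrt_nonneg _) _ fun X hX => ?_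
  obtain ⟨o, -, rfl⟩ := List.mem_map.mp hX
  exact pertLetter_inputs L a ha hL hd ha' hκ0 hγ' hδ' hJA hT0 hT₁ hT₂ hT₃ hV hV1 hu o

end Letters

/-! ## §2 The END for every u-derivative at every coupling of the disc -/

section Payoff

variable {α β a' κ T : ℝ} {V : (t : ℕ) → (k : ℕ) → Fin d → (idx L (cubic d (evenPeriod t)) k → ℂ)} {u₀ : ℂ}

/-- **`conv_iteratedDeriv_invPertCov_at_coupling` — EVERY u-DERIVATIVE OF `(c_k(u))⁻¹` AT EVERY COUPLING `u₀` OF THE DISC ON `ℤ^d`, MODULO ONLY THE BACKGROUND's POINTWISE LIMIT**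
[our proof] (`d ≥ 3`, `L ≥ 2`, `a > 0`, `μ ≠ ν`, even cubic volumes, PART 129's disc, `‖u₀‖ ≤ T`, every order `N`): the tower family `(t, k) ↦ ∂^N_u[(c_k(u))⁻¹]|_{u = u₀}` has the
β-cell's whole `LimitRate` END — PART 161's uniform Faà di Bruno identity at `u₀` (letters `c_k(u₀)⁻¹`, `X^{(j)}_k(u₀)`; `Δ_a + u₀P` invertible by (H-bd), `c_k(u₀)` by §1) +
`pertDiagramSum_inputs` + PART 140's generic END. [cite: Balaban1987RG1, (1.21)–(1.22) p.264 (shapes)] -/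
theorem conv_iteratedDeriv_invPertCov_at_coupling (hL : 2 ≤ L) (hd : 3 ≤ d) {μ ν : Fin d} (hne : μ ≠ ν) (ha' : 0 < a') (hκ0 : 0 < κ)
    (hγ' : Jfree d a' κ 1 < gammaPs d a') (hδ' : deltaK d a' κ 1 < sigma0 d a' ^ 2) (hJA : JA d a a' κ 1 < gamD d a) (hT0 : 0 ≤ T)
    (hT₁ : T * (d * (α + β) * Cst d a) ≤ 1 / 2)
    (hT₂ : T * (d * (α * G2 d a (max (JA d a a' κ 1) 0) (gamD d a - max (JA d a a' κ 1) 0) κ)) ≤ 1 / 2)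
    (hT₃ : 4 * T * (d * (α + β) * Cst d a) * Cst d a ≤ gammaB d a)
    (hV : ∀ t, LipschitzBackground L (cubic d (evenPeriod t)) (V t) α β)
    (hV1 : ∀ k (μ f : Fin d) (z : Fin d → ℤ), ∃ s : ℂ, Tendsto (fun t => V t k μ (castT (cubic d (lev L k * evenPeriod t)) z, f)) atTop (𝓝 s))
    (hu : ‖u₀‖ ≤ T) (N : ℕ) :
    ∃ κ₁ B B' : ℝ, 0 < κ₁ ∧ 0 ≤ B ∧ 0 ≤ B' ∧ ∃ Pinf : ℕ → B12Beta.Kernel d,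
      (∀ k, IsInfiniteVolumeLimit evenPeriod
        (fun t μ' ν' (x : Site d (evenPeriod t)) =>
          ((iteratedDeriv N (fun u : ℂ => (avgTow (QBlev L (cubic d (evenPeriod t))) ((L : ℝ) ^ d)
              (fun k' => (calDalev L (cubic d (evenPeriod t)) a ha k' + u • Pmodel L (cubic d (evenPeriod t)) (V t) k')⁻¹) k)⁻¹) u₀)
            ((unitIdx L (cubic d (evenPeriod t))).symm (x, μ')) ((unitIdx L (cubic d (evenPeriod t))).symm (0, ν'))).re) (Pinf k)) ∧
      Beta.LimitRate.UniformDecay Pinf μ ν B (κ₁ / d) ∧ StepRate Pinf μ ν B' (κ₁ / d) (Real.sqrt ((L : ℝ)⁻¹)) ∧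
      (∃ K : KernelInputs d Pinf, K.θ = Real.sqrt ((L : ℝ)⁻¹) ∧ K.c₀ = betaPrime510 d (B' / (1 - Real.sqrt ((L : ℝ)⁻¹))) (κ₁ / d) ∧ K.Pinf = limKernelOf Pinf ∧ K.μ = μ ∧ K.ν = ν) ∧
      (∀ k, |B12Beta.secondMoment (Pinf k) μ ν - B12Beta.secondMoment (limKernelOf Pinf) μ ν|
          ≤ betaPrime510 d (B' / (1 - Real.sqrt ((L : ℝ)⁻¹))) (κ₁ / d) * Real.sqrt ((L : ℝ)⁻¹) ^ k) := by
  have hd1 : 1 ≤ d := le_trans (by norm_num) hd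
  have hL1 : (1 : ℝ) < L := by exact_mod_cast (lt_of_lt_of_le one_lt_two hL : 1 < L)
  have hθ1 : Real.sqrt ((L : ℝ)⁻¹) < 1 := by
    rw [show (1 : ℝ) = Real.sqrt 1 from Real.sqrt_one.symm]
    exact Real.sqrt_lt_sqrt (inv_nonneg.mpr (Nat.cast_nonneg _)) (inv_lt_one_of_one_lt₀ hL1)
  have hκ₀0 : 0 ≤ d * (α + β) * Cst d a := by have := (hV 0).nonneg.1; have := (hV 0).nonneg.2; have := Cst_nonneg d a; positivity
  have ht₀ : ‖u₀‖ * (d * (α + β) * Cst d a) < 1 := by nlinarith [mul_le_mul_of_nonneg_right hu hκ₀0, norm_nonneg u₀]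
  obtain ⟨J, hJ, z, ℓ, hN⟩ := iteratedDeriv_inv_eq_diagramSum N
  obtain ⟨κ₁, B, B', hκ₁, hB, hB', hud, hsr, hel⟩ := pertDiagramSum_inputs L a ha hL hd ha' hκ0 hγ' hδ' hJA hT0 hT₁ hT₂ hT₃ hV hV1 hu Finset.univ (fun i => (z i : ℂ)) ℓ
  -- the identity at `u₀`, volume by volume
  have key : ∀ t k, iteratedDeriv N (fun u : ℂ => (avgTow (QBlev L (cubic d (evenPeriod t))) ((L : ℝ) ^ d)
        (fun k' => (calDalev L (cubic d (evenPeriod t)) a ha k' + u • Pmodel L (cubic d (evenPeriod t)) (V t) k')⁻¹) k)⁻¹) u₀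
      = (∑ i ∈ Finset.univ, (fun i => (z i : ℂ)) i • ((ℓ i).map fun o : Option ℕ => o.elim
          (fun t k => (avgTow (QBlev L (cubic d (evenPeriod t))) ((L : ℝ) ^ d)
            (fun k' => (calDalev L (cubic d (evenPeriod t)) a ha k' + u₀ • Pmodel L (cubic d (evenPeriod t)) (V t) k')⁻¹) k)⁻¹)
          (fun j t k => avgTow (QBlev L (cubic d (evenPeriod t))) ((L : ℝ) ^ d)
            (fun k' => ((calDalev L (cubic d (evenPeriod t)) a ha k' + u₀ • Pmodel L (cubic d (evenPeriod t)) (V t) k')⁻¹ * Pmodel L (cubic d (evenPeriod t)) (V t) k') ^ j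
              * (calDalev L (cubic d (evenPeriod t)) a ha k' + u₀ • Pmodel L (cubic d (evenPeriod t)) (V t) k')⁻¹) k)).prod) t k := by
    intro t k
    set M := cubic d (evenPeriod t) with hM
    obtain ⟨Φ, hΦ⟩ := exists_clm_avgTow (QBlev L M) ((L : ℝ) ^ d) k
    set D : Matrix (idx L M k) (idx L M k) ℂ := calDalev L M a ha k with hD
    set P : Matrix (idx L M k) (idx L M k) ℂ := Pmodel L M (V t) k with hP
    have hF : (fun u : ℂ => (avgTow (QBlev L M) ((L : ℝ) ^ d) (fun k' => (calDalev L M a ha k' + u • Pmodel L M (V t) k')⁻¹) k)⁻¹)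
        = fun u : ℂ => (Φ (D + u • P)⁻¹)⁻¹ := by
      funext u; rw [hΦ]
    have ec : Φ (D + u₀ • P)⁻¹ = avgTow (QBlev L M) ((L : ℝ) ^ d) (fun k' => (calDalev L M a ha k' + u₀ • Pmodel L M (V t) k')⁻¹) k :=
      (hΦ (fun k' => (calDalev L M a ha k' + u₀ • Pmodel L M (V t) k')⁻¹)).symm
    have h0 : IsUnit (D + u₀ • P).det := isUnit_det_add_smul_right (isUnit_det_calDalev L M a ha k) ((perturbationLaws_firstOrder L M a ha hd1 (hV t)).opNorm_P_mul_inv_le k) ht₀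
    have hc0 : IsUnit (Φ (D + u₀ • P)⁻¹).det := by rw [ec]; exact isUnit_det_pertCov L a ha hd1 M (hV t) hT₁ hT₃ hu k
    rw [hF, hN D P Φ u₀ h0 hc0, Finset.sum_apply, Finset.sum_apply]
    refine Finset.sum_congr rfl fun i _ => ?_
    rw [Pi.smul_apply, Pi.smul_apply, Pi.list_prod_apply, Pi.list_prod_apply, List.map_map, List.map_map]
    congr 1
    refine congrArg List.prod (List.map_congr_left fun o _ => ?_)
    cases o with
    | none =>
      simp only [Function.comp_apply, Option.elim, ec]
      rfl
    | some j =>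
      simp only [Function.comp_apply, Option.elim]
      rw [hΦ, InsertionChainLaw.pow_mul_shift]
  -- PART 140's generic END on the combination, then the identity
  have hlim := fun k (μ' ν' : Fin d) (w : Fin d → ℤ) => by
    have h := hel k μ' ν' w 0
    have e0 : ∀ t, castT (cubic d (evenPeriod t)) (0 : Fin d → ℤ) = 0 := fun t => by funext i; simp [castT]
    simp only [e0] at h
    exact h
  obtain ⟨Pinf, hP⟩ := conv_of_decay_of_tendsto L hd1 tendsto_evenPeriod hκ₁ (Real.sqrt_nonneg _) hθ1 hud hsr hlim hne
  refine ⟨κ₁, B, B', hκ₁, hB, hB', Pinf, fun k => ?_, hP.2⟩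
  have e : (fun t μ' ν' (x : Site d (evenPeriod t)) =>
      ((iteratedDeriv N (fun u : ℂ => (avgTow (QBlev L (cubic d (evenPeriod t))) ((L : ℝ) ^ d)
          (fun k' => (calDalev L (cubic d (evenPeriod t)) a ha k' + u • Pmodel L (cubic d (evenPeriod t)) (V t) k')⁻¹) k)⁻¹) u₀)
        ((unitIdx L (cubic d (evenPeriod t))).symm (x, μ')) ((unitIdx L (cubic d (evenPeriod t))).symm (0, ν'))).re)
      = fun t μ' ν' (x : Site d (evenPeriod t)) =>
      (((∑ i ∈ Finset.univ, (fun i => (z i : ℂ)) i • ((ℓ i).map fun o : Option ℕ => o.elim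
          (fun t k => (avgTow (QBlev L (cubic d (evenPeriod t))) ((L : ℝ) ^ d)
            (fun k' => (calDalev L (cubic d (evenPeriod t)) a ha k' + u₀ • Pmodel L (cubic d (evenPeriod t)) (V t) k')⁻¹) k)⁻¹)
          (fun j t k => avgTow (QBlev L (cubic d (evenPeriod t))) ((L : ℝ) ^ d)
            (fun k' => ((calDalev L (cubic d (evenPeriod t)) a ha k' + u₀ • Pmodel L (cubic d (evenPeriod t)) (V t) k')⁻¹ * Pmodel L (cubic d (evenPeriod t)) (V t) k') ^ j
              * (calDalev L (cubic d (evenPeriod t)) a ha k' + u₀ • Pmodel L (cubic d (evenPeriod t)) (V t) k')⁻¹) k)).prod) t k)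
        ((unitIdx L (cubic d (evenPeriod t))).symm (x, μ')) ((unitIdx L (cubic d (evenPeriod t))).symm (0, ν'))).re := by
    funext t μ' ν' x
    rw [key t k]
  rw [e]
  exact hP.1 k

/-- **`conv_iteratedDeriv_effFormPert_at_coupling` — EVERY u-DERIVATIVE (ORDER `N ≥ 1`) OF THE EFFECTIVE FORM WITH BACKGROUND `Σ_k(u) = c_k(u)⁻¹ − a″1` AT EVERY COUPLING `u₀` OF THE
DISC, ON `ℤ^d`** [our proof]: `∂^N_uΣ_k(u)|_{u₀} = ∂^N_u(c_k(u)⁻¹)|_{u₀}` (`iteratedDeriv_const_add`), then `conv_iteratedDeriv_invPertCov_at_coupling`.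
[cite: Balaban1987RG1, (1.21)–(1.22) p.264 (shapes)] -/
theorem conv_iteratedDeriv_effFormPert_at_coupling (hL : 2 ≤ L) (hd : 3 ≤ d) {μ ν : Fin d} (hne : μ ≠ ν) (ha' : 0 < a') (hκ0 : 0 < κ)
    (hγ' : Jfree d a' κ 1 < gammaPs d a') (hδ' : deltaK d a' κ 1 < sigma0 d a' ^ 2) (hJA : JA d a a' κ 1 < gamD d a) (hT0 : 0 ≤ T)
    (hT₁ : T * (d * (α + β) * Cst d a) ≤ 1 / 2)
    (hT₂ : T * (d * (α * G2 d a (max (JA d a a' κ 1) 0) (gamD d a - max (JA d a a' κ 1) 0) κ)) ≤ 1 / 2)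
    (hT₃ : 4 * T * (d * (α + β) * Cst d a) * Cst d a ≤ gammaB d a)
    (hV : ∀ t, LipschitzBackground L (cubic d (evenPeriod t)) (V t) α β)
    (hV1 : ∀ k (μ f : Fin d) (z : Fin d → ℤ), ∃ s : ℂ, Tendsto (fun t => V t k μ (castT (cubic d (lev L k * evenPeriod t)) z, f)) atTop (𝓝 s))
    (hu : ‖u₀‖ ≤ T) {N : ℕ} (hN : 0 < N) (a'' : ℂ) :
    ∃ κ₁ B B' : ℝ, 0 < κ₁ ∧ 0 ≤ B ∧ 0 ≤ B' ∧ ∃ Pinf : ℕ → B12Beta.Kernel d,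
      (∀ k, IsInfiniteVolumeLimit evenPeriod
        (fun t μ' ν' (x : Site d (evenPeriod t)) =>
          ((iteratedDeriv N (fun u : ℂ => (avgTow (QBlev L (cubic d (evenPeriod t))) ((L : ℝ) ^ d)
              (fun k' => (calDalev L (cubic d (evenPeriod t)) a ha k' + u • Pmodel L (cubic d (evenPeriod t)) (V t) k')⁻¹) k)⁻¹
              - a'' • (1 : Matrix (idx L (cubic d (evenPeriod t)) 0) (idx L (cubic d (evenPeriod t)) 0) ℂ)) u₀)
            ((unitIdx L (cubic d (evenPeriod t))).symm (x, μ')) ((unitIdx L (cubic d (evenPeriod t))).symm (0, ν'))).re) (Pinf k)) ∧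
      Beta.LimitRate.UniformDecay Pinf μ ν B (κ₁ / d) ∧ StepRate Pinf μ ν B' (κ₁ / d) (Real.sqrt ((L : ℝ)⁻¹)) ∧
      (∃ K : KernelInputs d Pinf, K.θ = Real.sqrt ((L : ℝ)⁻¹) ∧ K.c₀ = betaPrime510 d (B' / (1 - Real.sqrt ((L : ℝ)⁻¹))) (κ₁ / d) ∧ K.Pinf = limKernelOf Pinf ∧ K.μ = μ ∧ K.ν = ν) ∧
      (∀ k, |B12Beta.secondMoment (Pinf k) μ ν - B12Beta.secondMoment (limKernelOf Pinf) μ ν|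
          ≤ betaPrime510 d (B' / (1 - Real.sqrt ((L : ℝ)⁻¹))) (κ₁ / d) * Real.sqrt ((L : ℝ)⁻¹) ^ k) := by
  have e : ∀ t k, iteratedDeriv N (fun u : ℂ => (avgTow (QBlev L (cubic d (evenPeriod t))) ((L : ℝ) ^ d)
        (fun k' => (calDalev L (cubic d (evenPeriod t)) a ha k' + u • Pmodel L (cubic d (evenPeriod t)) (V t) k')⁻¹) k)⁻¹
        - a'' • (1 : Matrix (idx L (cubic d (evenPeriod t)) 0) (idx L (cubic d (evenPeriod t)) 0) ℂ)) u₀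
      = iteratedDeriv N (fun u : ℂ => (avgTow (QBlev L (cubic d (evenPeriod t))) ((L : ℝ) ^ d)
        (fun k' => (calDalev L (cubic d (evenPeriod t)) a ha k' + u • Pmodel L (cubic d (evenPeriod t)) (V t) k')⁻¹) k)⁻¹) u₀ := by
    intro t k
    have h := iteratedDeriv_const_add (𝕜 := ℂ) (x := u₀) hN
      (-(a'' • (1 : Matrix (idx L (cubic d (evenPeriod t)) 0) (idx L (cubic d (evenPeriod t)) 0) ℂ)))
      (f := fun u : ℂ => (avgTow (QBlev L (cubic d (evenPeriod t))) ((L : ℝ) ^ d)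
        (fun k' => (calDalev L (cubic d (evenPeriod t)) a ha k' + u • Pmodel L (cubic d (evenPeriod t)) (V t) k')⁻¹) k)⁻¹)
    simp only [neg_add_eq_sub] at h
    exact h
  simp only [e]
  exact conv_iteratedDeriv_invPertCov_at_coupling L a ha hL hd hne ha' hκ0 hγ' hδ' hJA hT0 hT₁ hT₂ hT₃ hV hV1 hu N

end Payoff

end Summit.QuantumFields.BalabanUV.Beta.GAN24.BackgroundExpansionTaylorCoupling

end
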